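import Summits.QuantumAdvantage.AdviceFreeQNC0.SymmetrisedCoverage
import HarnessLib

/-!
# Cell qa-qnc0 (rung F-Q1, route RingFrame, crux α, line `product`): the RELATIVE robust Hegedűs
# lemma — neighbouring Hamming layers at distance `q ≍ √n` carry comparable densities of a low-degree support

The lemma that HOME/qa-qnc0-p1/TARGET.md §17.5(vi) names as the missing input for PLDAMS at all
densities ("A RELATIVE robust Hegedűs lemma `nzFrac_P(k±q) ≤ K(c)·nzFrac_P(k)` … for `deg P ≤ c√n`,
`q = c'√n` would give PLDAMS by the residue-walking of §11; monomials show `K(c) ≥ e^{Ω(cc')}` is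
necessary"; and "[Srinivasan's] method genuinely stops" for sparse supports):

* `relativeHegedus` (**relative robust Hegedűs lemma, `𝔽₂`**): there are `c > 0` and `n₀` such that for
  `n ≥ n₀`, `q = 2^j` with `75n ≤ q²`, `100q < k < n − 100q`, `n/4 ≤ k ≤ 3n/4`, `d < c·q` and every
  `g ∈ lowDeg 𝔽₂ n d`, writing `ψ_k = nzFrac g k` for the fraction of layer `k` where `g ≠ 0`:
  `ψ_{k+q} ≤ K·ψ_k` and `ψ_{k−q} ≤ K·ψ_k` with `K = 2000·e^{400q²/n}` (a constant for `q ≍ √n`).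

So relative (not absolute) thinness propagates outward by steps `q ≍ √n`, for EVERY density of the
support — exactly what the residue walking of TARGET §11.3 / `lowDegAvoidMod3Sparse` needs to run
without its density hypothesis (qn-lit LIT-MEMO-11 §4: PLDAMS for all densities and `d ≤ c''√n` then
follows by (a) a tail lemma — masses halve per `q`-step beyond `≈ 100K√n`, so a third of the support
is central — and (b) the partner-layer count; that assembly is NOT in this file).

PROOF (the cell's; it IS Srinivasan's Lemma 3.1, fed a better polynomial).  Let `k' = k ± q`,
`ψ' = ψ_{k'} > 0`, `m = ⌈1/ψ'⌉`.  (1) LOCALISED SYMMETRISATION (`exists_perms_cover_on`): some `m`-tuple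
of coordinate permutations covers `≥ C(n,k')·(1 − (1−ψ')^m) ≥ ½·C(n,k')` points of layer `k'` by the
copies `{x : g(x∘π_i) ≠ 0}`, while on layer `k` the copies cover `≤ m·ψ_k·C(n,k)` points (every copy has
the layer counts of `g`, `card_filter_layer_comp_perm`).  (2) LOCALISED DEGREE-FREE OR-REDUCTION
(`exists_subset_sum_support_on_ge`, one round of Razborov): a sub-sum `P = Σ_{i∈S} g∘π_i`, of degree
`≤ d`, is non-zero on at least half of the covered points of layer `k'`: `nzFrac P k' ≥ ¼`, and
`nzFrac P k ≤ m·ψ_k ≤ 2ψ_k/ψ'`.  (3) Srinivasan's robust Hegedűs lemma (tree theorem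
`Hegedus.nzFrac_lt_of_lowDeg`, [Srinivasan2023, Lemma 3.1]): if `nzFrac P k ≤ θ₀ := min(e^{−100q²/(nα)}, 10⁻³)`
then `nzFrac P (k ± q) < e^{−q²/(100nα)} < ¼` (`α = alphaOf n k ∈ [¼, ½]`, `q² ≥ 75n`) — contradiction.
Hence `2ψ_k/ψ' > θ₀ ≥ e^{−400q²/n}/1000`, i.e. `ψ' < 2000·e^{400q²/n}·ψ_k`.  The point: the symmetrised
sub-sum turns RELATIVE fatness of layer `k'` (any `ψ' > 0`) into ABSOLUTE fatness (`≥ ¼`) while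
multiplying the density on layer `k` by the same factor `m ≈ 1/ψ'`, so only the ratio `ψ_k/ψ_{k'}` enters
Srinivasan's absolute-threshold lemma — the dual of its own amplification device (Lemma 3.10 multiplies
permuted copies to amplify vanishing; here we add them to amplify non-vanishing).
presearch: LIT-MEMO-8 (A1) and LIT-MEMO-11 §1–2 (relative/proportional robust Hegedűs: not in print).
WHAT THIS IS NOT: not yet PLDAMS (the walking/tail assembly is separate); constants astronomically far
from the conjectured `e^{Θ(cc')}`; nothing on `LDMAPolylog` or α directly; no separation.

## References

* S. Srinivasan, *A robust version of Hegedűs's lemma, with applications*, TheoretiCS 2 (2023),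
  Lemma 3.1 (the absolute lemma) and Lemma 3.10 (random permutations) [Srinivasan2023].
* A. A. Razborov, *Lower bounds on the size of bounded depth circuits over a complete basis with
  logical addition*, Math. Notes 41 (1987) — random sub-sums [Razborov1987].
-/

noncomputable section

namespace Summit.QuantumAdvantage.AdviceFreeQNC0

open Finset
open Literature.Computability.MetaComplexity Literature.Computability.MetaComplexity.Smolensky
open Literature.Computability.MetaComplexity.Hegedus

variable {n : ℕ}

section General

variable {F : Type*} [Field F] [DecidableEq F]

/-! ### Localised symmetrisation and sub-sum lemmas (on a fixed set of points `X`) -/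

/-- **Localised average cover.** For any set of points `X`, summed over all `m`-tuples of coordinate
permutations, the number of points of `X` covered by some copy `{x : g(x ∘ π_i) ≠ 0}` is
`(n!)^m · Σ_{x∈X} (1 − (1 − ψ_{|x|})^m)`. [cite: Srinivasan2023, Lemma 3.10 (a^π is uniform on its layer)] -/
theorem sum_card_cover_on_eq (g : CubeFn F n) (X : Finset (Fin n → Bool)) (m : ℕ) :
    ∑ πs : Fin m → Equiv.Perm (Fin n),
        ((X.filter fun x : Fin n → Bool => ∃ i, g (x ∘ ⇑(πs i)) ≠ 0).card : ℝ) =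
      (Fintype.card (Equiv.Perm (Fin n)) : ℝ) ^ m *
        ∑ x ∈ X, (1 - (1 - nzFrac g (wt x)) ^ m) := by
  classical
  have hswap : ∑ πs : Fin m → Equiv.Perm (Fin n),
      ((X.filter fun x : Fin n → Bool => ∃ i, g (x ∘ ⇑(πs i)) ≠ 0).card : ℝ) =
      ∑ x ∈ X, (((univ : Finset (Fin m → Equiv.Perm (Fin n))).filter
        fun πs : Fin m → Equiv.Perm (Fin n) => ∃ i, g (x ∘ ⇑(πs i)) ≠ 0).card : ℝ) := by
    simp only [card_filter, Nat.cast_sum]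
    rw [sum_comm]
  rw [hswap, mul_sum]
  refine sum_congr rfl fun x _ => ?_
  have hsplit := card_filter_add_card_filter_not (s := (univ : Finset (Fin m → Equiv.Perm (Fin n))))
    (fun πs : Fin m → Equiv.Perm (Fin n) => ∃ i, g (x ∘ ⇑(πs i)) ≠ 0)
  have hnot : ((univ : Finset (Fin m → Equiv.Perm (Fin n))).filter
      fun πs : Fin m → Equiv.Perm (Fin n) => ¬ ∃ i, g (x ∘ ⇑(πs i)) ≠ 0) =
      (univ : Finset (Fin m → Equiv.Perm (Fin n))).filter
        fun πs : Fin m → Equiv.Perm (Fin n) => ∀ i, g (x ∘ ⇑(πs i)) = 0 :=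
    filter_congr fun πs _ => by simp only [not_exists, ne_eq, not_not]
  rw [hnot, card_univ] at hsplit
  have hT : (Fintype.card (Fin m → Equiv.Perm (Fin n)) : ℝ) =
      (Fintype.card (Equiv.Perm (Fin n)) : ℝ) ^ m := by
    rw [Fintype.card_fun, Fintype.card_fin, Nat.cast_pow]
  have hcast : (((univ : Finset (Fin m → Equiv.Perm (Fin n))).filter
      fun πs : Fin m → Equiv.Perm (Fin n) => ∃ i, g (x ∘ ⇑(πs i)) ≠ 0).card : ℝ) =
      (Fintype.card (Equiv.Perm (Fin n)) : ℝ) ^ m -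
        ((Fintype.card (Equiv.Perm (Fin n)) : ℝ) * (1 - nzFrac g (wt x))) ^ m := by
    rw [← card_pi_perm_filter_forall_eq_zero g x m, ← hT]
    have := congrArg (fun t : ℕ => (t : ℝ)) hsplit
    push_cast at this
    linarith
  rw [hcast, mul_pow]
  ring

/-- **Localised symmetrisation (probabilistic method).** Some `m`-tuple of coordinate permutations
covers at least `Σ_{x∈X} (1 − (1 − ψ_{|x|})^m)` points of `X` with the copies `{x : g(x ∘ π_i) ≠ 0}`.
[cite: Srinivasan2023, Lemma 3.10 (a^π is uniform on its layer)] -/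
theorem exists_perms_cover_on (g : CubeFn F n) (X : Finset (Fin n → Bool)) (m : ℕ) :
    ∃ πs : Fin m → Equiv.Perm (Fin n),
      ∑ x ∈ X, (1 - (1 - nzFrac g (wt x)) ^ m) ≤
        ((X.filter fun x : Fin n → Bool => ∃ i, g (x ∘ ⇑(πs i)) ≠ 0).card : ℝ) := by
  classical
  have hsum : ∑ _πs : Fin m → Equiv.Perm (Fin n), (∑ x ∈ X, (1 - (1 - nzFrac g (wt x)) ^ m)) ≤
      ∑ πs : Fin m → Equiv.Perm (Fin n),
        ((X.filter fun x : Fin n → Bool => ∃ i, g (x ∘ ⇑(πs i)) ≠ 0).card : ℝ) := by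
    rw [sum_card_cover_on_eq, sum_const, card_univ, nsmul_eq_mul, Fintype.card_fun, Fintype.card_fin,
      Nat.cast_pow]
  obtain ⟨πs, _, hπs⟩ := exists_le_of_sum_le univ_nonempty hsum
  exact ⟨πs, hπs⟩

/-- **Localised degree-free OR-reduction.** For any finite family of cube functions and any set of
points `X`, some sub-sum `Σ_{i ∈ S} g_i` is non-zero on at least half of the points of `X` where some
`g_i` is non-zero. [cite: Razborov1987, the sub-sum approximation of OR] -/
theorem exists_subset_sum_support_on_ge {ι : Type*} [Fintype ι] [DecidableEq ι] (gs : ι → CubeFn F n)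
    (X : Finset (Fin n → Bool)) :
    ∃ S : Finset ι, (X.filter fun x : Fin n → Bool => ∃ i, gs i x ≠ 0).card ≤
      2 * (X.filter fun x : Fin n → Bool => (∑ i ∈ S, gs i) x ≠ 0).card := by
  classical
  set U : Finset (Fin n → Bool) := X.filter fun x : Fin n → Bool => ∃ i, gs i x ≠ 0 with hU
  have hcount : U.card * 2 ^ (Fintype.card ι) ≤
      2 * ∑ S ∈ (univ : Finset ι).powerset,
        (X.filter fun x : Fin n → Bool => (∑ i ∈ S, gs i) x ≠ 0).card := by
    have hx : ∀ x ∈ U, 2 ^ (Fintype.card ι) ≤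
        2 * ((univ : Finset ι).powerset.filter fun S => ∑ i ∈ S, gs i x ≠ 0).card := by
      intro x hx
      obtain ⟨i₀, hi₀⟩ := (mem_filter.1 hx).2
      rw [← Finset.card_univ]
      exact two_pow_le_two_mul_card_filter_sum_ne_zero univ (fun i => gs i x) (mem_univ i₀) hi₀
    calc U.card * 2 ^ (Fintype.card ι) = ∑ _x ∈ U, 2 ^ (Fintype.card ι) := by
          rw [sum_const, smul_eq_mul]
      _ ≤ ∑ x ∈ U, 2 * ((univ : Finset ι).powerset.filter fun S => ∑ i ∈ S, gs i x ≠ 0).card :=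
          sum_le_sum hx
      _ = 2 * ∑ x ∈ U, ((univ : Finset ι).powerset.filter fun S => ∑ i ∈ S, gs i x ≠ 0).card := by
          rw [mul_sum]
      _ ≤ 2 * ∑ x ∈ X, ((univ : Finset ι).powerset.filter fun S => ∑ i ∈ S, gs i x ≠ 0).card :=
          Nat.mul_le_mul_left 2 (sum_le_sum_of_subset_of_nonneg (filter_subset _ _)
            fun _ _ _ => Nat.zero_le _)
      _ = 2 * ∑ S ∈ (univ : Finset ι).powerset,
            (X.filter fun x : Fin n → Bool => (∑ i ∈ S, gs i) x ≠ 0).card := by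
          congr 1
          simp only [card_filter, Finset.sum_apply]
          exact sum_comm
  have havg : ∑ _S ∈ (univ : Finset ι).powerset, U.card ≤
      ∑ S ∈ (univ : Finset ι).powerset,
        2 * (X.filter fun x : Fin n → Bool => (∑ i ∈ S, gs i) x ≠ 0).card := by
    rw [sum_const, card_powerset, card_univ, smul_eq_mul, mul_comm, ← mul_sum]
    exact hcount
  obtain ⟨S, _, hS⟩ := exists_le_of_sum_le ⟨∅, empty_mem_powerset _⟩ havg
  exact ⟨S, hS⟩

/-- A permuted copy has the same layer counts as the original (`x ↦ x ∘ π` is a weight-preserving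
bijection). [cite: Srinivasan2023, Lemma 3.10 (a^π is uniform on its layer)] -/
theorem card_filter_layer_comp_perm (g : CubeFn F n) (π : Equiv.Perm (Fin n)) (k : ℕ) :
    ((layer n k).filter fun x : Fin n → Bool => g (x ∘ ⇑π) ≠ 0).card =
      ((layer n k).filter fun u : Fin n → Bool => g u ≠ 0).card := by
  refine card_bij (fun x _ => x ∘ ⇑π) (fun x hx => ?_) (fun x _ y _ h => ?_)
    (fun u hu => ⟨u ∘ ⇑π.symm, ?_, ?_⟩)
  · rw [mem_filter, mem_layer_iff] at hx ⊢
    rw [wt_comp_perm]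
    exact hx
  · funext i
    simpa using congrFun h (π.symm i)
  · rw [mem_filter, mem_layer_iff] at hu ⊢
    have : (u ∘ ⇑π.symm) ∘ ⇑π = u := by funext i; simp
    rw [this, wt_comp_perm]
    exact hu
  · funext i; simp

/-- On a layer the coverage weight is constant: `Σ_{x ∈ W_k} (1 − (1 − ψ_{|x|})^m) = C(n,k)·(1 − (1 − ψ_k)^m)`.
[folklore] -/
theorem sum_layer_cover_weight (g : CubeFn F n) (k m : ℕ) :
    ∑ x ∈ layer n k, (1 - (1 - nzFrac g (wt x)) ^ m) = (n.choose k : ℝ) * (1 - (1 - nzFrac g k) ^ m) := by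
  rw [sum_congr rfl fun x hx => by rw [mem_layer_iff.1 hx], sum_const, card_layer, nsmul_eq_mul]

end General

/-! ### Numerical facts -/

/-- `(1 − θ)^m ≤ 1/2` once `mθ ≥ 1` (`0 < θ ≤ 1`). [folklore] -/
private theorem one_sub_pow_le_half' {θ : ℝ} (hθ : 0 < θ) (hθ1 : θ ≤ 1) {m : ℕ} (hm : 1 ≤ (m : ℝ) * θ) :
    (1 - θ) ^ m ≤ 1 / 2 := by
  have hB : 1 + (m : ℝ) * θ ≤ (1 + θ) ^ m := one_add_mul_le_pow (by linarith) m
  have h2 : (2 : ℝ) ≤ (1 + θ) ^ m := by linarith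
  have hprod : (1 - θ) ^ m * (1 + θ) ^ m ≤ 1 := by
    rw [← mul_pow]
    exact pow_le_one₀ (by nlinarith) (by nlinarith)
  have hnn : 0 ≤ (1 - θ) ^ m := pow_nonneg (by linarith) m
  rw [le_div_iff₀ (by norm_num : (0 : ℝ) < 2)]
  nlinarith

/-- `e^{−3/2} < 1/4`. [folklore] -/
private theorem exp_neg_three_halves_lt : Real.exp (-(3 / 2 : ℝ)) < 1 / 4 := by
  have h1 : (2.7182818283 : ℝ) < Real.exp 1 := Real.exp_one_gt_d9
  have h2 : (1 / 2 : ℝ) + 1 ≤ Real.exp (1 / 2) := Real.add_one_le_exp _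
  have h3 : Real.exp (3 / 2 : ℝ) = Real.exp 1 * Real.exp (1 / 2) := by
    rw [← Real.exp_add]; norm_num
  have h4 : (4 : ℝ) < Real.exp (3 / 2) := by
    rw [h3]; nlinarith [Real.exp_pos (1 / 2 : ℝ), Real.exp_pos (1 : ℝ)]
  rw [Real.exp_neg, inv_eq_one_div, div_lt_div_iff_of_pos_left one_pos (Real.exp_pos _) (by norm_num)]
  exact h4

/-! ### The relative robust Hegedűs lemma -/

/-- **Relative robust Hegedűs lemma (`𝔽₂`).** There are `c > 0` and `n₀` such that for all `n ≥ n₀`,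
all `k, q, d` with `q` a power of `2`, `75n ≤ q²`, `100q < k`, `k + 100q < n`, `n ≤ 4k ≤ 3n`, `d < c·q`,
and every `g ∈ lowDeg 𝔽₂ n d`: the non-vanishing fractions of the layers `k ± q` are at most
`2000·e^{400q²/n}` times that of layer `k`.  The cell's (qa-qnc0, LIT-MEMO-11 §4); it is Srinivasan's
absolute lemma [cite: Srinivasan2023, Lemma 3.1] applied to a symmetrised sub-sum of `g`. -/
theorem relativeHegedus :
    ∃ c : ℝ, 0 < c ∧ ∃ n₀ : ℕ, ∀ n : ℕ, n₀ ≤ n → ∀ k q d : ℕ, (∃ j : ℕ, q = 2 ^ j) →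
      100 * q < k → k + 100 * q < n → n ≤ 4 * k → 4 * k ≤ 3 * n → 75 * n ≤ q ^ 2 → (d : ℝ) < c * q →
      ∀ g : CubeFn (ZMod 2) n, g ∈ lowDeg (ZMod 2) n d →
        nzFrac g (k + q) ≤ 2000 * Real.exp (400 * (q : ℝ) ^ 2 / n) * nzFrac g k ∧
        nzFrac g (k - q) ≤ 2000 * Real.exp (400 * (q : ℝ) ^ 2 / n) * nzFrac g k := by
  classical
  haveI : Fact (Nat.Prime 2) := ⟨Nat.prime_two⟩
  obtain ⟨cH, hcH, n₀, hSri⟩ := nzFrac_lt_of_lowDeg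
  refine ⟨cH, hcH, n₀, fun n hn k q d hq hk1 hk2 hk3 hk4 hqn hd g hg => ?_⟩
  -- the two thresholds of Srinivasan's lemma at `(n, k, q)`
  set θ₀ : ℝ := min (Real.exp (-(100 * (q : ℝ) ^ 2 / (n * alphaOf n k)))) (1 / 1000) with hθ₀
  set εB : ℝ := Real.exp (-((q : ℝ) ^ 2 / (100 * n * alphaOf n k))) with hεB
  set K : ℝ := 2000 * Real.exp (400 * (q : ℝ) ^ 2 / n) with hK
  have hn0 : 0 < n := by omega
  have hnR : (0 : ℝ) < n := by exact_mod_cast hn0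
  have hα1 : alphaOf n k ≤ 1 / 2 := alphaOf_le_half n k
  have hα2 : 1 / 4 ≤ alphaOf n k := quarter_le_alphaOf hn0 hk3 hk4
  have hαpos : 0 < alphaOf n k := by linarith
  have hq2 : (75 : ℝ) * n ≤ (q : ℝ) ^ 2 := by exact_mod_cast hqn
  -- `εB < 1/4`
  have hεB_lt : εB < 1 / 4 := by
    have hexp : (3 / 2 : ℝ) ≤ (q : ℝ) ^ 2 / (100 * n * alphaOf n k) := by
      rw [le_div_iff₀ (by positivity)]
      calc (3 / 2 : ℝ) * (100 * n * alphaOf n k) = 150 * n * alphaOf n k := by ring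
        _ ≤ 150 * n * (1 / 2) := mul_le_mul_of_nonneg_left hα1 (by positivity)
        _ = 75 * n := by ring
        _ ≤ (q : ℝ) ^ 2 := hq2
    calc εB ≤ Real.exp (-(3 / 2 : ℝ)) := Real.exp_le_exp.2 (by linarith)
      _ < 1 / 4 := exp_neg_three_halves_lt
  -- `θ₀ ≥ e^{−400q²/n}/1000`, so `2 ≤ K θ₀`
  have hθ₀pos : 0 < θ₀ := lt_min (Real.exp_pos _) (by norm_num)
  set E : ℝ := Real.exp (400 * (q : ℝ) ^ 2 / n) with hEdef
  set Em : ℝ := Real.exp (-(400 * (q : ℝ) ^ 2 / n)) with hEmdef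
  have hEpos : 0 < E := Real.exp_pos _
  have hEmpos : 0 < Em := Real.exp_pos _
  have hEm1 : Em ≤ 1 := Real.exp_le_one_iff.2 (neg_nonpos.2 (by positivity))
  have hinv : E * Em = 1 := by
    rw [hEdef, hEmdef, ← Real.exp_add, add_neg_cancel, Real.exp_zero]
  have hθ₀K : 2 ≤ K * θ₀ := by
    have hE : Em ≤ Real.exp (-(100 * (q : ℝ) ^ 2 / (n * alphaOf n k))) := by
      refine Real.exp_le_exp.2 (neg_le_neg ?_)
      have hα4 : 100 / alphaOf n k ≤ 400 := by
        rw [div_le_iff₀ hαpos]; linarith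
      have hrew : 100 * (q : ℝ) ^ 2 / (n * alphaOf n k) = 100 / alphaOf n k * ((q : ℝ) ^ 2 / n) := by
        field_simp
      rw [hrew, show 400 * (q : ℝ) ^ 2 / n = 400 * ((q : ℝ) ^ 2 / n) by ring]
      exact mul_le_mul_of_nonneg_right hα4 (by positivity)
    have hmin : Em * (1 / 1000) ≤ θ₀ := by
      rw [hθ₀]
      rcases le_total (Real.exp (-(100 * (q : ℝ) ^ 2 / (n * alphaOf n k)))) (1 / 1000) with h | h
      · rw [min_eq_left h]
        calc Em * (1 / 1000) ≤ Em * 1 := mul_le_mul_of_nonneg_left (by norm_num) hEmpos.le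
          _ = Em := mul_one _
          _ ≤ _ := hE
      · rw [min_eq_right h]
        calc Em * (1 / 1000) ≤ 1 * (1 / 1000) := mul_le_mul_of_nonneg_right hEm1 (by norm_num)
          _ = 1 / 1000 := one_mul _
    calc (2 : ℝ) = 2000 * (E * Em) * (1 / 1000) := by rw [hinv]; ring
      _ = 2000 * E * (Em * (1 / 1000)) := by ring
      _ ≤ 2000 * E * θ₀ := mul_le_mul_of_nonneg_left hmin (by positivity)
      _ = K * θ₀ := by rw [hK]
  -- the core: for a layer `k' ≤ n` controlled by Srinivasan's lemma from layer `k`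
  have core : ∀ k' : ℕ, k' ≤ n →
      (∀ P : CubeFn (ZMod 2) n, P ∈ lowDeg (ZMod 2) n d → nzFrac P k ≤ θ₀ → nzFrac P k' < εB) →
      nzFrac g k' ≤ K * nzFrac g k := by
    intro k' hk'n hthin
    set ψ' : ℝ := nzFrac g k' with hψ'
    set ψ : ℝ := nzFrac g k with hψ
    have hψ'0 : 0 ≤ ψ' := nzFrac_nonneg g k'
    have hψ'1 : ψ' ≤ 1 := nzFrac_le_one g k'
    have hψ0 : 0 ≤ ψ := nzFrac_nonneg g k
    have hKpos : 0 < K := by rw [hK]; positivity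
    rcases hψ'0.eq_or_lt with hz | hpos
    · rw [← hz]; exact mul_nonneg hKpos.le hψ0
    -- number of copies
    set m : ℕ := ⌈1 / ψ'⌉₊ with hm
    have hm1 : 1 ≤ (m : ℝ) * ψ' := by
      have : 1 / ψ' ≤ (m : ℝ) := Nat.le_ceil _
      calc (1 : ℝ) = 1 / ψ' * ψ' := by field_simp
        _ ≤ (m : ℝ) * ψ' := by nlinarith
    have hm2 : (m : ℝ) * ψ' ≤ 2 := by
      have : (m : ℝ) < 1 / ψ' + 1 := Nat.ceil_lt_add_one (by positivity)
      calc (m : ℝ) * ψ' ≤ (1 / ψ' + 1) * ψ' := by nlinarith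
        _ = 1 + ψ' := by field_simp
        _ ≤ 2 := by linarith
    have hck' : (0 : ℝ) < n.choose k' := by exact_mod_cast Nat.choose_pos hk'n
    have hck : (0 : ℝ) < n.choose k := by exact_mod_cast Nat.choose_pos (by omega)
    -- (1) localised cover of layer `k'`
    obtain ⟨πs, hπs⟩ := exists_perms_cover_on g (layer n k') m
    rw [sum_layer_cover_weight] at hπs
    -- (2) a good sub-sum
    obtain ⟨S, hS⟩ := exists_subset_sum_support_on_ge
      (fun i : Fin m => fun x : Fin n → Bool => g (x ∘ ⇑(πs i))) (layer n k')
    set P : CubeFn (ZMod 2) n := ∑ i ∈ S, fun x : Fin n → Bool => g (x ∘ ⇑(πs i)) with hP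
    have hPdeg : P ∈ lowDeg (ZMod 2) n d :=
      Submodule.sum_mem _ fun i _ => comp_perm_mem_lowDeg (πs i) hg
    -- `P` is fat on layer `k'`: `nzFrac P k' ≥ 1/4`
    have hPk' : (1 / 4 : ℝ) ≤ nzFrac P k' := by
      have hhalf : (1 - ψ') ^ m ≤ 1 / 2 := one_sub_pow_le_half' hpos hψ'1 hm1
      have hcov : (n.choose k' : ℝ) * (1 / 2) ≤
          (((layer n k').filter fun x : Fin n → Bool => ∃ i, g (x ∘ ⇑(πs i)) ≠ 0).card : ℝ) := by
        refine le_trans ?_ hπs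
        exact mul_le_mul_of_nonneg_left (by linarith) hck'.le
      have hS' : (((layer n k').filter fun x : Fin n → Bool => ∃ i, g (x ∘ ⇑(πs i)) ≠ 0).card : ℝ) ≤
          2 * (((layer n k').filter fun x : Fin n → Bool => P x ≠ 0).card : ℝ) := by
        exact_mod_cast hS
      unfold nzFrac
      rw [le_div_iff₀ hck']
      linarith
    -- `P` is thin on layer `k`: `nzFrac P k ≤ m·ψ`
    have hPk : nzFrac P k ≤ (m : ℝ) * ψ := by
      have hsub : ((layer n k).filter fun x : Fin n → Bool => P x ≠ 0) ⊆
          (univ : Finset (Fin m)).biUnion fun i =>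
            (layer n k).filter fun x : Fin n → Bool => g (x ∘ ⇑(πs i)) ≠ 0 := by
        intro u hu
        rw [mem_filter] at hu
        rw [mem_biUnion]
        by_contra hall
        push Not at hall
        apply hu.2
        rw [hP, Finset.sum_apply]
        refine sum_eq_zero fun i hi => ?_
        by_contra hne
        exact hall i (mem_univ i) (mem_filter.2 ⟨hu.1, hne⟩)
      have hle := (card_le_card hsub).trans card_biUnion_le
      rw [sum_congr rfl fun i _ => card_filter_layer_comp_perm g (πs i) k, sum_const, card_univ,
        Fintype.card_fin, smul_eq_mul] at hle
      have hle' : (((layer n k).filter fun x : Fin n → Bool => P x ≠ 0).card : ℝ) ≤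
          (m : ℝ) * (((layer n k).filter fun u : Fin n → Bool => g u ≠ 0).card : ℝ) := by
        exact_mod_cast hle
      rw [hψ]
      unfold nzFrac
      rw [div_le_iff₀ hck] at *
      rw [mul_assoc, div_mul_cancel₀ _ hck.ne']
      exact hle'
    -- (3) Srinivasan's lemma forces `m·ψ > θ₀`
    have hnot : ¬ nzFrac P k ≤ θ₀ := fun h => by
      have := hthin P hPdeg h
      linarith
    have hmψ : θ₀ < (m : ℝ) * ψ := by
      by_contra h
      exact hnot (hPk.trans (not_lt.1 h))
    -- conclude `ψ' ≤ K ψ`: `θ₀ ψ' < m ψ ψ' ≤ 2ψ`, and `2 ≤ K θ₀`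
    have h1 : θ₀ * ψ' ≤ 2 * ψ :=
      calc θ₀ * ψ' ≤ ((m : ℝ) * ψ) * ψ' := mul_le_mul_of_nonneg_right hmψ.le hψ'0
        _ = ψ * ((m : ℝ) * ψ') := by ring
        _ ≤ ψ * 2 := mul_le_mul_of_nonneg_left hm2 hψ0
        _ = 2 * ψ := by ring
    have h2 : 2 * ψ' ≤ K * (θ₀ * ψ') :=
      calc 2 * ψ' ≤ (K * θ₀) * ψ' := mul_le_mul_of_nonneg_right hθ₀K hψ'0
        _ = K * (θ₀ * ψ') := by ring
    have h3 : K * (θ₀ * ψ') ≤ K * (2 * ψ) := mul_le_mul_of_nonneg_left h1 hKpos.le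
    linarith
  -- apply the core to `k + q` and `k − q`
  have hthin : ∀ P : CubeFn (ZMod 2) n, P ∈ lowDeg (ZMod 2) n d → nzFrac P k ≤ θ₀ →
      nzFrac P (k + q) < εB ∧ nzFrac P (k - q) < εB := by
    intro P hP hPk
    obtain ⟨j, hj⟩ := hq
    exact hSri 2 (ZMod 2) n hn k q d ⟨j, hj⟩ hk1 hk2 hd P hP hPk
  exact ⟨core (k + q) (by omega) fun P hP h => (hthin P hP h).1,
    core (k - q) (by omega) fun P hP h => (hthin P hP h).2⟩

end Summit.QuantumAdvantage.AdviceFreeQNC0
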